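import Mathlib
import Literature.Computability.AlgebraicComplexity.DetInVP
import Literature.Computability.AlgebraicComplexity.ArithCircuitProofs
import Summits.ValiantsHypothesis.ValiantsHypothesis.Theorems.DivisionGapZeroOneTransferSparsePolyComplexity

/-!
# Crux `DivisionGap.ZeroOneTransfer` (stmt-ValiantsHypothesis-5066), line `charged-uncharged` —
registered stub `stub_residualIMM`: THE RESIDUAL AUTOMATON IS AN ITERATED MATRIX PRODUCT

**Claim settled** (stub C3 of the lead's skeleton, TRUE; the monotone/deterministic form of
Nisan's width characterisation of algebraic branching programs, Nisan 1991, Thm. 1).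
Fix `f ∈ ℝ≥0[x₀, …, x_{N-1}]` with individual degrees `≤ d`; the PREFIX-RESIDUAL at cut `i` and
prefix exponent `u` is `res f i u = Σ_{m ∈ supp f, m|_{<i} = u} coeff_m(f) · X^{m|_{≥ i}}`.  If at
every cut `i ≤ N` at most `W` distinct residuals occur, then `f = IMM_{W+1,N+2}(g)` for a
substitution `g` of the variables of `immPoly (W+1) (N+2) ℝ≥0 = tr(X⁽⁰⁾ ⋯ X⁽ᴺ⁺¹⁾)` by
polynomials of monotone complexity `≤ (d+1)²`.

Proof.  `res f 0 0 = f` (`res_zero_zero`), `res f N u = C (coeff_u f)` (`res_top`), and the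
TRANSITION `res f i u = Σ_{j ≤ d} x_i^j · res f (i+1) (u + j·e_i)` for prefix-supported `u`,
`i < N` (`res_step`: regroup the monomials with prefix `u` by their `x_i`-exponent).  Encode the
finite residual set at cut `i` injectively into `Fin (W+1)` (`idx`, from `ncard ≤ W`), decode by
`vec`.  Layer `0` is the matrix unit at `(0, idx 0 f)`, layer `i+1` (`i < N`) the transition
matrix `trans i` (row `a`: the powers `x_i^j`, `j ≤ d`, sorted by the class of
`res f (i+1) (u_a + j·e_i)`, for a chosen prefix-supported representative `u_a` of class `a`; zero
row if there is none, and then the class is `0`), layer `N+1` the constant column `vec N`.  Then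
`vec i = trans i *ᵥ vec (i+1)` (`vec_step`), the product of layers `1 … N+1` at column `0`
telescopes to `vec 0` (`mulVec_prod_map_range`), and the trace against the matrix unit is
`vec 0 (idx 0 f) = f` (`trace_prod_layer`, `aeval_immPoly`).  Cost: every entry is `0`, `1`, a
constant, or `Σ_{j ∈ J} x_i^j`, `J ⊆ {0, …, d}`, of complexity `≤ |J|·d + |J| ≤ (d+1)²`.

Helper namespace `ResidualIMM`.  Unconditional (axioms `propext`, `Classical.choice`,
`Quot.sound`).  Reference: N. Nisan, *Lower bounds for non-commutative computation*, STOC 1991,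
Thm. 1 (bib key `Nisan1991Noncommutative`).
-/

noncomputable section

-- `Summit.ValiantsHypothesis.ValiantsHypothesis.…` is the tree's mandated layout (Sub = Summit).
set_option linter.dupNamespace false

namespace Summit.ValiantsHypothesis.ValiantsHypothesis.Theorems.DivisionGapZeroOneTransfer

open MvPolynomial Literature.Computability.AlgebraicComplexity
open scoped NNReal Matrix

namespace ResidualIMM

variable {N W : ℕ}

/-- The part of the exponent vector `m` strictly before the cut `i`. [folklore] -/
def pre (i : ℕ) (m : Fin N →₀ ℕ) : Fin N →₀ ℕ := Finsupp.filter (fun j : Fin N => (j : ℕ) < i) m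

/-- The part of the exponent vector `m` at or after the cut `i`. [folklore] -/
def suf (i : ℕ) (m : Fin N →₀ ℕ) : Fin N →₀ ℕ := Finsupp.filter (fun j : Fin N => i ≤ (j : ℕ)) m

/-- Pointwise value of the prefix. [folklore] -/
@[simp] theorem pre_apply (i : ℕ) (m : Fin N →₀ ℕ) (k : Fin N) :
    pre i m k = if (k : ℕ) < i then m k else 0 := rfl

/-- Pointwise value of the suffix. [folklore] -/
@[simp] theorem suf_apply (i : ℕ) (m : Fin N →₀ ℕ) (k : Fin N) :
    suf i m k = if i ≤ (k : ℕ) then m k else 0 := rfl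

/-- The prefix-residual of `f` at cut `i` and prefix exponent `u`:
`Σ_{m ∈ supp f, pre i m = u} coeff_m(f) · X^{suf i m}`. [cite: Nisan1991Noncommutative, Thm. 1] -/
def res (f : MvPolynomial (Fin N) ℝ≥0) (i : ℕ) (u : Fin N →₀ ℕ) : MvPolynomial (Fin N) ℝ≥0 :=
  ∑ m ∈ f.support with pre i m = u, monomial (suf i m) (coeff m f)

/-- The set of prefix-residuals of `f` at cut `i`. [cite: Nisan1991Noncommutative, Thm. 1] -/
def resSet (f : MvPolynomial (Fin N) ℝ≥0) (i : ℕ) : Set (MvPolynomial (Fin N) ℝ≥0) :=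
  {g | ∃ u : Fin N →₀ ℕ, g = res f i u}

/-- The residual set is finite: every residual is the residual of the prefix of a support
monomial, or `0`. [folklore] -/
theorem resSet_finite (f : MvPolynomial (Fin N) ℝ≥0) (i : ℕ) : (resSet f i).Finite := by
  refine (((f.support.finite_toSet.image (pre i)).image (res f i)).insert 0).subset ?_
  rintro g ⟨u, rfl⟩
  by_cases hu : ∃ m ∈ f.support, pre i m = u
  · obtain ⟨m, hm, hmu⟩ := hu
    exact Set.mem_insert_of_mem _ ⟨u, ⟨m, hm, hmu⟩, rfl⟩
  · refine Set.mem_insert_iff.2 (Or.inl (Finset.sum_eq_zero fun m hm => ?_))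
    exact absurd ⟨m, (Finset.mem_filter.1 hm).1, (Finset.mem_filter.1 hm).2⟩ hu

/-- A prefix exponent with nonzero suffix has residual `0` (no monomial has that prefix: the
suffix of a prefix vanishes). [folklore] -/
theorem res_eq_zero_of_suf_ne_zero (f : MvPolynomial (Fin N) ℝ≥0) {i : ℕ} {u : Fin N →₀ ℕ}
    (hu : suf i u ≠ 0) : res f i u = 0 := by
  refine Finset.sum_eq_zero fun m hm => absurd (Finsupp.ext fun k => ?_) hu
  rw [← (Finset.mem_filter.1 hm).2, suf_apply, pre_apply, Finsupp.coe_zero, Pi.zero_apply]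
  split_ifs <;> omega

/-- At cut `0` the residual of the empty prefix is `f` itself. [folklore] -/
theorem res_zero_zero (f : MvPolynomial (Fin N) ℝ≥0) : res f 0 0 = f := by
  unfold res
  rw [Finset.filter_true_of_mem fun m _ => Finsupp.ext fun k => by simp]
  conv_rhs => rw [f.as_sum]
  refine Finset.sum_congr rfl fun m _ => ?_
  rw [show suf 0 m = m from Finsupp.ext fun k => by simp]

/-- At cut `N` every residual is a constant: `res f N u = C (coeff_u f)`. [folklore] -/
theorem res_top (f : MvPolynomial (Fin N) ℝ≥0) (u : Fin N →₀ ℕ) : res f N u = C (coeff u f) := by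
  classical
  have hpre : ∀ m : Fin N →₀ ℕ, pre N m = m := fun m => Finsupp.ext fun k => by simp [k.2]
  have hsuf : ∀ m : Fin N →₀ ℕ, suf N m = 0 := fun m => Finsupp.ext fun k => by
    simp [Nat.not_le.2 k.2]
  unfold res
  simp_rw [hpre, hsuf, Finset.sum_filter, Finset.sum_ite_eq', ← C_apply]
  split_ifs with h
  · rfl
  · rw [notMem_support_iff.1 h, C_0]

/-- The suffix at cut `i` splits off the `x_i`-exponent. [folklore] -/
theorem suf_split {i : ℕ} (hi : i < N) (m : Fin N →₀ ℕ) :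
    suf i m = Finsupp.single (⟨i, hi⟩ : Fin N) (m ⟨i, hi⟩) + suf (i + 1) m := by
  ext ⟨k, hk⟩
  simp only [suf_apply, Finsupp.add_apply, Finsupp.single_apply, Fin.mk.injEq]
  rcases Nat.lt_trichotomy k i with h | rfl | h
  · split_ifs <;> omega
  · rw [if_pos le_rfl, if_pos rfl, if_neg (by omega), add_zero]
  · split_ifs <;> omega

/-- The fibre condition of the transition: for a prefix-supported `u`, a monomial `m` has prefix
`u` at cut `i` and `x_i`-exponent `j` iff it has prefix `u + j·e_i` at cut `i+1`. [folklore] -/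
theorem pre_eq_and_iff {i : ℕ} (hi : i < N) {u : Fin N →₀ ℕ} (hu : suf i u = 0)
    (m : Fin N →₀ ℕ) (j : ℕ) :
    (pre i m = u ∧ m ⟨i, hi⟩ = j) ↔ pre (i + 1) m = u + Finsupp.single ⟨i, hi⟩ j := by
  have hu' : ∀ k : Fin N, i ≤ (k : ℕ) → u k = 0 := fun k hk => by
    have h := DFunLike.congr_fun hu k
    rwa [suf_apply, if_pos hk] at h
  constructor
  · rintro ⟨rfl, rfl⟩
    ext ⟨k, hk⟩
    simp only [pre_apply, Finsupp.add_apply, Finsupp.single_apply, Fin.mk.injEq]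
    rcases Nat.lt_trichotomy k i with h | rfl | h
    · split_ifs <;> omega
    · rw [if_pos (Nat.lt_succ_self k), if_neg (lt_irrefl k), if_pos rfl, zero_add]
    · split_ifs <;> omega
  · intro H
    have Hk := fun k => DFunLike.congr_fun H k
    simp only [pre_apply, Finsupp.add_apply, Finsupp.single_apply] at Hk
    refine ⟨?_, ?_⟩
    · ext ⟨k, hk⟩
      have h1 := Hk ⟨k, hk⟩
      simp only [Fin.mk.injEq] at h1
      rw [pre_apply]
      rcases Nat.lt_or_ge k i with h | h
      · rw [if_pos (by omega), if_neg (by omega), add_zero] at h1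
        rw [if_pos h, h1]
      · rw [if_neg (Nat.not_lt.2 h)]
        exact (hu' ⟨k, hk⟩ h).symm
    · have h1 := Hk ⟨i, hi⟩
      rw [if_pos (Nat.lt_succ_self i), if_pos rfl, hu' ⟨i, hi⟩ le_rfl, zero_add] at h1
      exact h1

/-- **The transition identity**: for `i < N` and a prefix-supported `u`,
`res f i u = Σ_{j ≤ d} x_i^j · res f (i+1) (u + j·e_i)` (regroup the monomials with prefix `u` by
their `x_i`-exponent `j ≤ d`). [cite: Nisan1991Noncommutative, Thm. 1] -/
theorem res_step (f : MvPolynomial (Fin N) ℝ≥0) {d : ℕ} (hd : ∀ m ∈ f.support, ∀ j : Fin N, m j ≤ d)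
    {i : ℕ} (hi : i < N) {u : Fin N →₀ ℕ} (hu : suf i u = 0) :
    res f i u = ∑ j ∈ Finset.range (d + 1), (X ⟨i, hi⟩ : MvPolynomial (Fin N) ℝ≥0) ^ j *
      res f (i + 1) (u + Finsupp.single ⟨i, hi⟩ j) := by
  unfold res
  rw [← Finset.sum_fiberwise_of_maps_to (s := f.support.filter fun m => pre i m = u)
    (t := Finset.range (d + 1)) (g := fun m : Fin N →₀ ℕ => m ⟨i, hi⟩)
    (fun m hm => Finset.mem_range.2 (Nat.lt_succ_of_le (hd m (Finset.filter_subset _ _ hm) _)))]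
  refine Finset.sum_congr rfl fun j _ => ?_
  rw [Finset.filter_filter, Finset.mul_sum]
  refine Finset.sum_congr (Finset.filter_congr fun m _ => pre_eq_and_iff hi hu m j) fun m hm => ?_
  rw [X_pow_eq_monomial, monomial_mul, one_mul, suf_split hi m,
    ((pre_eq_and_iff hi hu m j).2 (Finset.mem_filter.1 hm).2).2]

/-- A finite set with `ncard ≤ W` injects into `Fin (W+1)`. [folklore] -/
theorem exists_injOn_fin {α : Type*} {s : Set α} (hs : s.Finite) (hW : s.ncard ≤ W) :
    ∃ φ : α → Fin (W + 1), Set.InjOn φ s := by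
  have hle : s.encard ≤ (Set.univ : Set (Fin (W + 1))).encard := by
    rw [Set.encard_univ, ENat.card_eq_coe_fintype_card, Fintype.card_fin, ← hs.cast_ncard_eq]
    exact_mod_cast hW.trans (Nat.le_succ W)
  obtain ⟨φ, -, hφ⟩ := hs.exists_injOn_of_encard_le hle
  exact ⟨φ, hφ⟩

open Classical in
/-- Decoding: `vec i b` is the residual at cut `i` encoded by `b` (zero off the image of `idx i`).
[folklore] -/
def vec (f : MvPolynomial (Fin N) ℝ≥0) (idx : ℕ → MvPolynomial (Fin N) ℝ≥0 → Fin (W + 1)) (i : ℕ)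
    (b : Fin (W + 1)) : MvPolynomial (Fin N) ℝ≥0 :=
  if h : ∃ Q ∈ resSet f i, idx i Q = b then h.choose else 0

/-- `vec i b` is an encoded residual, or `0`. [folklore] -/
theorem vec_spec (f : MvPolynomial (Fin N) ℝ≥0) (idx : ℕ → MvPolynomial (Fin N) ℝ≥0 → Fin (W + 1))
    (i : ℕ) (b : Fin (W + 1)) :
    (vec f idx i b ∈ resSet f i ∧ idx i (vec f idx i b) = b) ∨ vec f idx i b = 0 := by
  unfold vec
  split_ifs with h
  · exact Or.inl h.choose_spec
  · exact Or.inr rfl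

/-- Decoding inverts the encoding on the residual set. [folklore] -/
theorem vec_idx (f : MvPolynomial (Fin N) ℝ≥0) (idx : ℕ → MvPolynomial (Fin N) ℝ≥0 → Fin (W + 1))
    {i : ℕ} (hinj : Set.InjOn (idx i) (resSet f i)) {Q : MvPolynomial (Fin N) ℝ≥0}
    (hQ : Q ∈ resSet f i) : vec f idx i (idx i Q) = Q := by
  have h : ∃ Q' ∈ resSet f i, idx i Q' = idx i Q := ⟨Q, hQ, rfl⟩
  unfold vec
  rw [dif_pos h]
  exact hinj h.choose_spec.1 hQ h.choose_spec.2

open Classical in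
/-- The transition matrix at cut `i < N`: row `a` lists, for a chosen prefix-supported
representative `u_a` of the class `a`, the powers `x_i^j` (`j ≤ d`) leading to the class `b` at
cut `i+1`; zero row if `a` has no prefix-supported representative.
[cite: Nisan1991Noncommutative, Thm. 1] -/
def trans (f : MvPolynomial (Fin N) ℝ≥0) (d : ℕ) (idx : ℕ → MvPolynomial (Fin N) ℝ≥0 → Fin (W + 1))
    (i : ℕ) (a b : Fin (W + 1)) : MvPolynomial (Fin N) ℝ≥0 :=
  if h : i < N ∧ ∃ u : Fin N →₀ ℕ, suf i u = 0 ∧ idx i (res f i u) = a then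
    ∑ j ∈ (Finset.range (d + 1)).filter
        (fun j => idx (i + 1) (res f (i + 1) (h.2.choose + Finsupp.single ⟨i, h.1⟩ j)) = b),
      (X ⟨i, h.1⟩ : MvPolynomial (Fin N) ℝ≥0) ^ j
  else 0

/-- The layers of the substitution: the matrix unit at `(0, idx 0 f)`, the `N` transition
matrices, and the constant column `vec N` (junk beyond `N+1`).
[cite: Nisan1991Noncommutative, Thm. 1] -/
def layer (f : MvPolynomial (Fin N) ℝ≥0) (d : ℕ)
    (idx : ℕ → MvPolynomial (Fin N) ℝ≥0 → Fin (W + 1)) :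
    ℕ → Matrix (Fin (W + 1)) (Fin (W + 1)) (MvPolynomial (Fin N) ℝ≥0)
  | 0 => Matrix.single 0 (idx 0 f) 1
  | t + 1 => if t < N then Matrix.of (trans f d idx t)
      else Matrix.of fun a b => if b = 0 then vec f idx N a else 0

/-- Summing a fibred sum against a vector. [folklore] -/
theorem sum_filter_mul_eq {κ R : Type*} [Fintype κ] [DecidableEq κ] [NonUnitalNonAssocSemiring R]
    (s : Finset ℕ) (g : ℕ → κ) (F : ℕ → R) (v : κ → R) :
    ∑ b, (∑ j ∈ s with g j = b, F j) * v b = ∑ j ∈ s, F j * v (g j) := by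
  rw [← Finset.sum_fiberwise s g fun j => F j * v (g j)]
  refine Finset.sum_congr rfl fun b _ => ?_
  rw [Finset.sum_mul]
  exact Finset.sum_congr rfl fun j hj => by rw [(Finset.mem_filter.1 hj).2]

/-- **One step of the automaton**: the class vector at cut `i` is the transition matrix applied to
the class vector at cut `i+1`. [cite: Nisan1991Noncommutative, Thm. 1] -/
theorem vec_step (f : MvPolynomial (Fin N) ℝ≥0) {d : ℕ} (hd : ∀ m ∈ f.support, ∀ j : Fin N, m j ≤ d)
    (idx : ℕ → MvPolynomial (Fin N) ℝ≥0 → Fin (W + 1))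
    (hidx : ∀ i, i ≤ N → Set.InjOn (idx i) (resSet f i)) {i : ℕ} (hi : i < N) :
    vec f idx i = Matrix.of (trans f d idx i) *ᵥ vec f idx (i + 1) := by
  classical
  funext a
  change vec f idx i a = ∑ b, trans f d idx i a b * vec f idx (i + 1) b
  by_cases h : i < N ∧ ∃ u : Fin N →₀ ℕ, suf i u = 0 ∧ idx i (res f i u) = a
  · have ht : ∀ b, trans f d idx i a b = ∑ j ∈ (Finset.range (d + 1)).filter
        (fun j => idx (i + 1) (res f (i + 1) (h.2.choose + Finsupp.single ⟨i, hi⟩ j)) = b),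
          (X ⟨i, hi⟩ : MvPolynomial (Fin N) ℝ≥0) ^ j := fun b => by
      unfold trans
      rw [dif_pos h]
    have hva : vec f idx i a = res f i h.2.choose := by
      have hv := vec_idx f idx (hidx i hi.le) ⟨h.2.choose, rfl⟩
      rwa [h.2.choose_spec.2] at hv
    simp_rw [ht]
    rw [sum_filter_mul_eq, hva, res_step f hd hi h.2.choose_spec.1]
    exact Finset.sum_congr rfl fun j _ => by rw [vec_idx f idx (hidx (i + 1) hi) ⟨_, rfl⟩]
  · have ht : ∀ b, trans f d idx i a b = 0 := fun b => by
      unfold trans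
      rw [dif_neg h]
    simp_rw [ht, zero_mul, Finset.sum_const_zero]
    rcases vec_spec f idx i a with ⟨⟨u, hu⟩, hia⟩ | h0
    · rw [hu]
      refine res_eq_zero_of_suf_ne_zero f fun hsuf => h ⟨hi, u, hsuf, ?_⟩
      rw [← hu]
      exact hia
    · exact h0

/-- **Telescoping**: if `v i = M i *ᵥ v (i+1)` for `i < n` then `(M 0 ⋯ M (n-1)) *ᵥ v n = v 0`.
[folklore] -/
theorem mulVec_prod_map_range {ι R : Type*} [Fintype ι] [DecidableEq ι] [Semiring R]
    (M : ℕ → Matrix ι ι R) (v : ℕ → ι → R) (n : ℕ) (h : ∀ i, i < n → v i = M i *ᵥ v (i + 1)) :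
    ((List.range n).map M).prod *ᵥ v n = v 0 := by
  induction n with
  | zero => simp
  | succ n ih =>
    rw [List.range_succ, List.map_append, List.map_singleton, List.prod_append,
      List.prod_singleton, ← Matrix.mulVec_mulVec, ← h n (Nat.lt_succ_self n)]
    exact ih fun i hi => h i (Nat.lt_succ_of_lt hi)

/-- **The trace of the layer product is `f`.** [cite: Nisan1991Noncommutative, Thm. 1] -/
theorem trace_prod_layer (f : MvPolynomial (Fin N) ℝ≥0) {d : ℕ}
    (hd : ∀ m ∈ f.support, ∀ j : Fin N, m j ≤ d)
    (idx : ℕ → MvPolynomial (Fin N) ℝ≥0 → Fin (W + 1))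
    (hidx : ∀ i, i ≤ N → Set.InjOn (idx i) (resSet f i)) :
    (((List.range (N + 2)).map (layer f d idx)).prod).trace = f := by
  rw [List.range_succ_eq_map, List.map_cons, List.prod_cons, List.map_map, List.range_succ,
    List.map_append, List.prod_append, List.map_singleton, List.prod_singleton]
  have hmid : ((List.range N).map (layer f d idx ∘ Nat.succ)).prod *ᵥ vec f idx N = vec f idx 0 :=
    mulVec_prod_map_range _ _ N fun i hi => by
      show vec f idx i = layer f d idx (i + 1) *ᵥ vec f idx (i + 1)
      simp only [layer, if_pos hi]
      exact vec_step f hd idx hidx hi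
  have hlast : ∀ c, (layer f d idx ∘ Nat.succ) N c 0 = vec f idx N c := fun c => by
    show layer f d idx (N + 1) c 0 = _
    simp [layer]
  show (Matrix.single (0 : Fin (W + 1)) (idx 0 f) (1 : MvPolynomial (Fin N) ℝ≥0) * _).trace = f
  rw [Matrix.trace_single_mul, one_smul, Matrix.mul_apply]
  simp_rw [hlast]
  change (((List.range N).map (layer f d idx ∘ Nat.succ)).prod *ᵥ vec f idx N) (idx 0 f) = f
  rw [hmid, vec_idx f idx (hidx 0 (Nat.zero_le N)) ⟨0, (res_zero_zero f).symm⟩]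

/-- A sub-sum of `1, x, …, x^d` costs at most `(d+1)²` gates. [folklore] -/
theorem complexity_sum_X_pow_le {d : ℕ} (x : Fin N) (T : Finset ℕ)
    (hT : T ⊆ Finset.range (d + 1)) :
    complexity (∑ j ∈ T, (X x : MvPolynomial (Fin N) ℝ≥0) ^ j) ≤ (d + 1) ^ 2 := by
  have hcard : T.card ≤ d + 1 := (Finset.card_le_card hT).trans_eq (Finset.card_range _)
  calc complexity (∑ j ∈ T, (X x : MvPolynomial (Fin N) ℝ≥0) ^ j)
      ≤ ∑ j ∈ T, complexity ((X x : MvPolynomial (Fin N) ℝ≥0) ^ j) + T.card :=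
        complexity_finset_sum_le _ _
    _ ≤ ∑ _j ∈ T, d + T.card := by
        gcongr with j hj
        exact (SparsePoly.complexity_X_pow_le x j).trans
          (Nat.lt_succ_iff.1 (Finset.mem_range.1 (hT hj)))
    _ ≤ (d + 1) * d + (d + 1) := by
        rw [Finset.sum_const, smul_eq_mul]
        gcongr
    _ = (d + 1) ^ 2 := by ring

/-- Every entry of every layer costs at most `(d+1)²` gates. [folklore] -/
theorem complexity_layer_le (f : MvPolynomial (Fin N) ℝ≥0) (d : ℕ)
    (idx : ℕ → MvPolynomial (Fin N) ℝ≥0 → Fin (W + 1)) (t : ℕ) (a b : Fin (W + 1)) :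
    complexity (layer f d idx t a b) ≤ (d + 1) ^ 2 := by
  have h0 : complexity (0 : MvPolynomial (Fin N) ℝ≥0) = 0 := by
    simpa using complexity_C_holds (σ := Fin N) (0 : ℝ≥0)
  have h1 : complexity (1 : MvPolynomial (Fin N) ℝ≥0) = 0 := by
    simpa using complexity_C_holds (σ := Fin N) (1 : ℝ≥0)
  cases t with
  | zero =>
    show complexity
      (Matrix.single (0 : Fin (W + 1)) (idx 0 f) (1 : MvPolynomial (Fin N) ℝ≥0) a b) ≤ _
    by_cases hab : (0 : Fin (W + 1)) = a ∧ idx 0 f = b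
    · rw [← hab.1, ← hab.2, Matrix.single_apply_same, h1]
      exact Nat.zero_le _
    · rw [Matrix.single_apply_of_ne _ _ _ _ _ hab, h0]
      exact Nat.zero_le _
  | succ t =>
    show complexity ((if t < N then Matrix.of (trans f d idx t)
      else Matrix.of fun a b => if b = 0 then vec f idx N a else 0) a b) ≤ _
    split_ifs with ht
    · rw [Matrix.of_apply]
      unfold trans
      split_ifs with h
      · exact complexity_sum_X_pow_le _ _ (Finset.filter_subset _ _)
      · rw [h0]
        exact Nat.zero_le _
    · rw [Matrix.of_apply]
      split_ifs
      · rcases vec_spec f idx N a with ⟨⟨u, hu⟩, -⟩ | hz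
        · rw [hu, res_top, complexity_C_holds]
          exact Nat.zero_le _
        · rw [hz, h0]
          exact Nat.zero_le _
      · rw [h0]
        exact Nat.zero_le _

end ResidualIMM

open ResidualIMM in
/-- **Stub C3 — THE RESIDUAL AUTOMATON IS AN ITERATED MATRIX PRODUCT.**  If at every cut `i ≤ N`
the polynomial `f ∈ ℝ≥0[x₀,…,x_{N-1}]` (individual degrees `≤ d`) has at most `W` distinct
prefix-residuals, then `f` is obtained from the tree's iterated-matrix-multiplication polynomial
`immPoly (W+1) (N+2) ℝ≥0 = tr(X⁽⁰⁾ ⋯ X⁽ᴺ⁺¹⁾)` by substituting, for every variable `X⁽ᵗ⁾_{ab}`, a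
polynomial of monotone complexity `≤ (d+1)²`: layer `0` the matrix unit selecting the class of
`f = residual_0(0)`, layer `i+1` (`i < N`) the TRANSITION MATRIX with `(a,b)` entry
`Σ {x_i^j : j ≤ d, residual_{i+1}(u_a + j·e_i) = b-th class}` for a chosen representative `u_a` of
the `a`-th residual class at cut `i`, layer `N+1` the constant column of the classes at cut `N`
— because `residual_i(u) = Σ_{j ≤ d} x_i^j · residual_{i+1}(u + j·e_i)` for prefix-supported `u`.
(Nisan 1991, Thm. 1: the ABP-width characterisation; here its monotone/deterministic form.)
[cite: Nisan1991Noncommutative, Thm. 1] -/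
theorem stub_residualIMM :
    ∀ (N d W : ℕ) (f : MvPolynomial (Fin N) NNReal),
      (∀ m ∈ f.support, ∀ j : Fin N, m j ≤ d) →
      (∀ i : ℕ, i ≤ N →
        {g : MvPolynomial (Fin N) NNReal | ∃ u : Fin N →₀ ℕ,
            g = ∑ m ∈ f.support with Finsupp.filter (fun j : Fin N => (j : ℕ) < i) m = u,
                  MvPolynomial.monomial (Finsupp.filter (fun j : Fin N => i ≤ (j : ℕ)) m)
                    (MvPolynomial.coeff m f)}.ncard ≤ W) →
      ∃ g : Fin (N + 2) × Fin (W + 1) × Fin (W + 1) → MvPolynomial (Fin N) NNReal,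
        f = MvPolynomial.aeval g (immPoly (W + 1) (N + 2) NNReal) ∧
        ∀ t, Literature.Computability.AlgebraicComplexity.complexity (g t) ≤ (d + 1) ^ 2 := by
  intro N d W f hd hW
  have hex : ∀ i : ℕ, ∃ φ : MvPolynomial (Fin N) ℝ≥0 → Fin (W + 1),
      i ≤ N → Set.InjOn φ (resSet f i) := fun i => by
    by_cases hi : i ≤ N
    · obtain ⟨φ, hφ⟩ := exists_injOn_fin (resSet_finite f i) (hW i hi)
      exact ⟨φ, fun _ => hφ⟩
    · exact ⟨fun _ => 0, fun h => absurd h hi⟩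
  choose idx hidx using hex
  refine ⟨fun t => layer f d idx t.1 t.2.1 t.2.2, ?_, fun t => complexity_layer_le f d idx _ _ _⟩
  rw [aeval_immPoly]
  change f = (((List.finRange (N + 2)).map
    (layer f d idx ∘ fun u : Fin (N + 2) => (u : ℕ))).prod).trace
  rw [← List.map_map, List.map_coe_finRange_eq_range]
  exact (trace_prod_layer f hd idx hidx).symm

end Summit.ValiantsHypothesis.ValiantsHypothesis.Theorems.DivisionGapZeroOneTransfer
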